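import Mathlib
import Literature.RingTheory.CohomologyAnnihilator.SyzygyDescentClosure
import Literature.RingTheory.CohomologyAnnihilator.RegularLocalRing
import Literature.RingTheory.CohomologyAnnihilator.RegularRing
import Literature.AlgebraicGeometry.Resolution.RankOneReductionProofs
import Summits.ResolutionOfSingularities.ResolutionOfSingularities.Theses.HomologicalConductor
import Summits.ResolutionOfSingularities.ResolutionOfSingularities.Theorems.HomologicalConductorNoZenoBirthDefs
import Summits.ResolutionOfSingularities.ResolutionOfSingularities.Theorems.HomologicalConductorNoZenoTowerNoetherian
import Summits.ResolutionOfSingularities.ResolutionOfSingularities.Theorems.HomologicalConductorPersistenceRadical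
import Summits.ResolutionOfSingularities.ResolutionOfSingularities.Theorems.HomologicalConductorPersistenceSTDStep
import HarnessLib

/-!
# `Persistence` from STD along the tower (line `birth`, candidate reshape 5: the composition)

Crux `HomologicalConductor.Persistence` (stmt-ResolutionOfSingularities-16484), chain W4.4b,
mechanism M-A′ (`[OURS · L1 w44b]`; assignment T3a/T3c of the chain plan v0.5; bookkeeping over
landed lemmas — replaces the role of no printed item; NOT a statement of any manuscript).

STD_{t,e}(B → C) says: every `e`-th syzygy of every finitely generated `C`-module lies in the
Ω-closure (iso / ⊕ / retract / first syzygy, containing the finitely generated projectives) of the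
strict transforms `C · φ(Y₀)` of `(t+1)`-th `B`-syzygies `Y₀`. Two spellings are in the tree: the
named inductive `Literature.RingTheory.CohomologyAnnihilator.OmegaClosure` / `STD` (p467408) and the
universal-property form of `Theorems/HomologicalConductorPersistenceSTDCore.lean` (p466272);
`omegaClosure_iff_forall` / `std_iff_forall` identify them.

Composition (T3a). For the canonical tower `T_m = tower O A m` of the route:

* `ca_subset_ca_succ_of_STD` — if STD_{t,e}(T_m → T_(m+1)) holds for every `t` (some `e`), with
  the inclusion as algebra structure, then `ca (T_m) ⊆ ca (T_(m+1))` (the step of the crux):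
  `T_m`, `T_(m+1)` are noetherian with `Frac T_m = K` (`tn_tower_invariant`), so the library
  transport `Subalgebra.algebraMap_mem_cohomologyAnnihilatorOfDegree_of_STD` applies;
  `ca_subset_ca_succ_of_forall` is the same with STD spelled by the universal property, VERBATIM
  the hypothesis of stub-2's `PersistenceSTDStep.image_coe_subset_image_coe_of_omegaClosure`;
* `persistence_of_STD` — the crux's conclusion `∀ m, ca (tower O A m) ⊆ ca (tower O A (m+1))`
  with the route binders verbatim, from STD at every step; `Persistence_of_STD` — the route decl
  `Persistence` BY NAME from the globally quantified STD hypothesis (named form), and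
  `persistence_of_STD_tower` — the same in the planner's binder shape (`PlanSignaturesSTD-v0.3`:
  the hypothesis is `stub_STD_tower` with `STDHom (Subalgebra.inclusion hle).toRingHom t e`
  unfolded): the shape of a reshape-5 skeleton with ONE x-free structural stub.

Sanity rung (T3c): `STD_of_cohomologyAnnihilatorOfDegree_eq_top` — if `caᵈ⁺¹(C) = C` (e.g. `C`
regular of dimension `d`: `STD_of_isRegularLocalRing`, `STD_of_isRegularRing`) then STD_{t,d}
holds for every `t` (a `d`-th syzygy is then a finitely generated projective, in the closure by fiat).

References: Iyengar–Takahashi, IMRN 2016 [`IyengarTakahashi2014`]; Esentepe, J. Algebra 2020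
[`Esentepe2018`].
-/

-- single-problem summit: the doubled namespace component `ResolutionOfSingularities` is forced
set_option linter.dupNamespace false

noncomputable section

open CategoryTheory CategoryTheory.Abelian

open scoped nonZeroDivisors

universe u

namespace Summit.ResolutionOfSingularities.ResolutionOfSingularities.Theorems.HomologicalConductor.PersistenceOfSTD

open Summit.ResolutionOfSingularities.ResolutionOfSingularities.Theses.HomologicalConductor
open Literature.RingTheory.CohomologyAnnihilator hiding ca caFrom
open Literature.RingTheory.Localization
open Literature.AlgebraicGeometry.Resolution (isFractionRing_subalgebra_of_le)
open Summit.ResolutionOfSingularities.ResolutionOfSingularities.Theorems.NoZeno.Birth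
  (ca tower tower_succ ca_subset tn_coe_mem_ca_iff tn_tower_invariant)
open Summit.ResolutionOfSingularities.ResolutionOfSingularities.Theorems.HomologicalConductor.PersistenceRadical
  (ca_eq_image)
open Summit.ResolutionOfSingularities.ResolutionOfSingularities.Theorems.HomologicalConductor.PersistenceSTDStep
  (exists_mul_mem_of_isFractionRing image_coe_subset_image_coe_of_omegaClosure)

/-! ## The two spellings of the Ω-closure and of STD agree -/

section Bridge

variable {C : Type u} [CommRing C]

/-- **Inductive Ω-closure = universal property**: `Y ∈ OmegaClosure G` iff `Y` belongs to every
class containing `G` and the finitely generated projectives that is closed under isomorphism,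
binary products, retracts and first syzygies (→ by induction, ← at the class `OmegaClosure G`
itself). [cite: IyengarTakahashi2014, Def. 4.1] -/
theorem omegaClosure_iff_forall (G : ModuleCat.{u} C → Prop) (Y : ModuleCat.{u} C) :
    OmegaClosure G Y ↔ ∀ Q : ModuleCat.{u} C → Prop,
      (∀ Y : ModuleCat.{u} C, G Y → Q Y) →
      (∀ P : ModuleCat.{u} C, Module.Finite C P → Projective P → Q P) →
      (∀ Y Y' : ModuleCat.{u} C, Q Y → Nonempty (Y ≅ Y') → Q Y') →
      (∀ Y₁ Y₂ : ModuleCat.{u} C, Q Y₁ → Q Y₂ → Q (ModuleCat.of C (Y₁ × Y₂))) →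
      (∀ (Y Y' : ModuleCat.{u} C) (i : Y' ⟶ Y) (r : Y ⟶ Y'), i ≫ r = 𝟙 Y' → Q Y → Q Y') →
      (∀ Y K : ModuleCat.{u} C, Q Y → IsSyzygy 1 Y K → Q K) → Q Y := by
  constructor
  · intro hY Q h1 h2 h3 h4 h5 h6
    induction hY with
    | base h => exact h1 _ h
    | proj hfin hproj => exact h2 _ hfin hproj
    | iso _ hiso ih => exact h3 _ _ ih hiso
    | prod _ _ ih₁ ih₂ => exact h4 _ _ ih₁ ih₂
    | retract i r h _ ih => exact h5 _ _ i r h ih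
    | syzygy _ hs ih => exact h6 _ _ ih hs
  · intro h
    exact h (OmegaClosure G) (fun _ hG => OmegaClosure.base hG)
      (fun _ hfin hproj => OmegaClosure.proj hfin hproj) (fun _ _ hY hiso => OmegaClosure.iso hY hiso)
      (fun _ _ h₁ h₂ => OmegaClosure.prod h₁ h₂) (fun _ _ i r h hY => OmegaClosure.retract i r h hY)
      (fun _ _ hY hs => OmegaClosure.syzygy hY hs)

variable {B : Type u} [CommRing B] [Algebra B C]

/-- **Named STD = universal-property STD**: `STD B C t e` (library, inductive Ω-closure) iff the
hypothesis of `PersistenceSTDCore.algebraMap_mem_cohomologyAnnihilatorOfDegree_of_omegaClosure`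
(every `e`-th syzygy lies in every suitably closed class containing the strict transforms of
`(t+1)`-th `B`-syzygies). [cite: Esentepe2018, Thm. 5.1] -/
theorem std_iff_forall (t e : ℕ) :
    STD B C t e ↔ ∀ (M K : ModuleCat.{u} C), Module.Finite C M → IsSyzygy e M K →
      ∀ Q : ModuleCat.{u} C → Prop,
        (∀ Y : ModuleCat.{u} C, (∃ (X Y₀ : ModuleCat.{u} B) (φ : Y₀ →+ Y), Module.Finite B X ∧
            IsSyzygy (t + 1) X Y₀ ∧ (∀ (b : B) (y : Y₀), φ (b • y) = algebraMap B C b • φ y) ∧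
            Function.Injective φ ∧ Submodule.span C (Set.range φ) = ⊤) → Q Y) →
        (∀ P : ModuleCat.{u} C, Module.Finite C P → Projective P → Q P) →
        (∀ Y Y' : ModuleCat.{u} C, Q Y → Nonempty (Y ≅ Y') → Q Y') →
        (∀ Y₁ Y₂ : ModuleCat.{u} C, Q Y₁ → Q Y₂ → Q (ModuleCat.of C (Y₁ × Y₂))) →
        (∀ (Y Y' : ModuleCat.{u} C) (i : Y' ⟶ Y) (r : Y ⟶ Y'), i ≫ r = 𝟙 Y' → Q Y → Q Y') →
        (∀ Y K : ModuleCat.{u} C, Q Y → IsSyzygy 1 Y K → Q K) → Q K := by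
  constructor
  · intro h M K hM hK Q h1 h2 h3 h4 h5 h6
    exact (omegaClosure_iff_forall _ K).mp (h M K hM hK) Q h1 h2 h3 h4 h5 h6
  · intro h M K hM hK
    exact (omegaClosure_iff_forall _ K).mpr (h M K hM hK)

end Bridge

/-! ## Sanity rung (T3c): regular targets satisfy STD -/

section Regular

variable {B C : Type u} [CommRing B] [CommRing C] [Algebra B C]

/-- Dimension shifting for projective dimension along a syzygy chain: if `K` is an `s`-th syzygy of
`M` and `pd M < n + 1 + s` then `pd K < n + 1`.
[cite: IyengarTakahashi2014, Example 2.5] -/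
theorem hasProjectiveDimensionLT_of_isSyzygy :
    ∀ (s : ℕ) {M K : ModuleCat.{u} C}, IsSyzygy s M K → ∀ n : ℕ,
      HasProjectiveDimensionLT M (n + 1 + s) → HasProjectiveDimensionLT K (n + 1)
  -- adapted from the private lemma of Literature/RingTheory/CohomologyAnnihilator/StrongGeneratorFiltration.lean
  | 0, _, _, ⟨e⟩, n, h => by
    haveI : HasProjectiveDimensionLT _ (n + 1) := h
    exact hasProjectiveDimensionLT_of_iso e.symm (n + 1)
  | s + 1, _, _, ⟨K', P, hK', _, hP, f, g, w, hS⟩, n, h => by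
    have h' : HasProjectiveDimensionLT K' (n + 1 + 1) :=
      hasProjectiveDimensionLT_of_isSyzygy s hK' (n + 1)
        (by rwa [show n + 1 + 1 + s = n + 1 + (s + 1) by omega])
    haveI : Projective P := hP
    have hP' : HasProjectiveDimensionLT (ShortComplex.mk f g w).X₂ (n + 1) :=
      hasProjectiveDimensionLT_of_ge P 1 (n + 1) (by omega)
    exact hS.hasProjectiveDimensionLT_X₁ (n + 1) hP' h'

/-- **`caᵈ⁺¹(C) = C` ⇒ STD_{t,d}(B → C) for every `t`** (sanity rung T3c): every finitely generated
`C`-module then has projective dimension `≤ d` ([IyengarTakahashi2014, Example 2.5]), so each of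
its `d`-th syzygies is a finitely generated projective — in the Ω-closure by the projective
constructor, whatever the generating class. [cite: IyengarTakahashi2014, Example 2.5] -/
theorem STD_of_cohomologyAnnihilatorOfDegree_eq_top [IsNoetherianRing C] {d : ℕ}
    (h : cohomologyAnnihilatorOfDegree C (d + 1) = ⊤) (t : ℕ) : STD B C t d := by
  intro M K hM hK
  haveI := hM
  have hKfin : Module.Finite C K := finite_of_isSyzygy d hM hK
  have hMpd : HasProjectiveDimensionLT M (0 + 1 + d) := by
    rw [Nat.zero_add, Nat.add_comm]
    exact hasProjectiveDimensionLT_of_cohomologyAnnihilatorOfDegree_eq_top h M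
  have hKpd : HasProjectiveDimensionLT K (0 + 1) := hasProjectiveDimensionLT_of_isSyzygy d hK 0 hMpd
  have hKproj : Projective K := projective_iff_hasProjectiveDimensionLT_one.mpr (by simpa using hKpd)
  exact OmegaClosure.proj hKfin hKproj

/-- **A regular local target of dimension `d` satisfies STD_{t,d} for every `t`**
(`caᵈ⁺¹ = ⊤` for a regular local ring of dimension `d`, Serre / [IyengarTakahashi2014, Ex. 2.5]).
[cite: IyengarTakahashi2014, Example 2.5] -/
theorem STD_of_isRegularLocalRing [IsRegularLocalRing C] {d : ℕ} (hd : ringKrullDim C = d)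
    (t : ℕ) : STD B C t d :=
  STD_of_cohomologyAnnihilatorOfDegree_eq_top
    (cohomologyAnnihilatorOfDegree_eq_top_of_isRegularLocalRing C hd) t

/-- **A regular target of Krull dimension `≤ n` satisfies STD_{t,n} for every `t`.**
[cite: IyengarTakahashi2014, Example 2.5] -/
theorem STD_of_isRegularRing [IsRegularRing C] {n : ℕ} (hn : ringKrullDim C ≤ n) (t : ℕ) :
    STD B C t n :=
  STD_of_cohomologyAnnihilatorOfDegree_eq_top
    (cohomologyAnnihilatorOfDegree_eq_top_of_isRegularRing C hn) t

end Regular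

/-! ## The composition (T3a): STD along the tower ⇒ `Persistence` -/

variable {k K : Type} [Field k] [Field K] [Algebra k K]

/-- **STD ⇒ `ca B ⊆ ca C` for `k`-subalgebras `B ≤ C` of `K` (named form; the shape of one
tower step).** Let `B ≤ C` be noetherian `k`-subalgebras of `K` with `Frac B = K`, the inclusion
as algebra structure. If for every `c ∈ ca(↥B)` and every `t` with `c ∈ caᵗ⁺¹(↥B)` some
STD_{t,e}(`↥B → ↥C`) holds, then `ca B ⊆ ca C` as subsets of `K` (library transport
`Subalgebra.algebraMap_mem_cohomologyAnnihilatorOfDegree_of_STD`; `C ⊆ Frac B` by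
`exists_mul_mem_of_isFractionRing`). Twin of stub-2's
`PersistenceSTDStep.image_coe_subset_image_coe_of_omegaClosure` for the named `STD`.
[cite: Esentepe2018, Thm. 5.1] -/
theorem ca_subset_ca_of_STD (B C : Subalgebra k K) (hBC : B ≤ C)
    [IsNoetherianRing ↥B] [IsNoetherianRing ↥C] [IsFractionRing ↥B K]
    (hSTD : letI := (Subalgebra.inclusion hBC).toRingHom.toAlgebra
      ∀ c : ↥B, c ∈ cohomologyAnnihilator ↥B →
      ∀ t : ℕ, c ∈ cohomologyAnnihilatorOfDegree ↥B (t + 1) → ∃ e : ℕ, STD ↥B ↥C t e) :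
    ca B ⊆ ca C := by
  letI : Algebra ↥B ↥C := (Subalgebra.inclusion hBC).toRingHom.toAlgebra
  haveI : IsScalarTower ↥B ↥C K := Subalgebra.isScalarTower_inclusion hBC
  intro x hx
  set g : ↥B := ⟨x, ca_subset _ hx⟩
  have hg : g ∈ cohomologyAnnihilator ↥B := (tn_coe_mem_ca_iff _ g).mp hx
  obtain ⟨n, hn⟩ := mem_cohomologyAnnihilator_iff.mp hg
  have hn' : g ∈ cohomologyAnnihilatorOfDegree ↥B (n + 1) :=
    cohomologyAnnihilatorOfDegree_mono (Nat.le_succ n) hn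
  obtain ⟨e, he⟩ := hSTD g hg n hn'
  have hmem := Subalgebra.algebraMap_mem_cohomologyAnnihilatorOfDegree_of_STD
    (exists_mul_mem_of_isFractionRing B C) he hn'
  have hcoe : ((algebraMap ↥B ↥C g : ↥C) : K) = x := rfl
  rw [← hcoe]
  exact (tn_coe_mem_ca_iff _ _).mpr (cohomologyAnnihilatorOfDegree_le (e + 1) hmem)

/-- **One tower step from STD (named form).** For the canonical tower of a finitely generated
`A ⊆ O` with `Frac A = K`: if, with the inclusion `T_m → T_(m+1)` as algebra structure,
STD_{t,e}(T_m → T_(m+1)) holds for every `t` (some `e = e(t)`), then `ca (T_m) ⊆ ca (T_(m+1))`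
(`hle : T_m ≤ T_(m+1)` is any proof of the inclusion — `T_(m+1) = loc (nrm (chart T_m)) ⊇ T_m`;
it is a parameter so that the statement names no auxiliary lemma). Both stages are noetherian
with `Frac T_m = K` (`tn_tower_invariant`), so `ca_subset_ca_of_STD` applies. [cite: Esentepe2018, Thm. 5.1] -/
theorem ca_subset_ca_succ_of_STD (O : ValuationSubring K) (A : Subalgebra k K)
    (hk : ∀ c : k, algebraMap k K c ∈ O) (hA : A.FG) (hfr : IsFractionRing ↥A K)
    (hAO : A.toSubring ≤ O.toSubring) (m : ℕ) (hle : tower O A m ≤ tower O A (m + 1))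
    (hSTD : letI := (Subalgebra.inclusion hle).toRingHom.toAlgebra
      ∀ t : ℕ, ∃ e : ℕ, STD ↥(tower O A m) ↥(tower O A (m + 1)) t e) :
    ca (tower O A m) ⊆ ca (tower O A (m + 1)) := by
  obtain ⟨hAT, -, hET⟩ := tn_tower_invariant O A hk hA hfr hAO m
  obtain ⟨-, -, hET'⟩ := tn_tower_invariant O A hk hA hfr hAO (m + 1)
  haveI := hET
  haveI := hET'
  haveI := hfr
  haveI : IsNoetherianRing ↥(tower O A m) := Algebra.EssFiniteType.isNoetherianRing k _
  haveI : IsNoetherianRing ↥(tower O A (m + 1)) := Algebra.EssFiniteType.isNoetherianRing k _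
  haveI : IsFractionRing ↥(tower O A m) K := isFractionRing_subalgebra_of_le A _ hAT
  exact ca_subset_ca_of_STD (tower O A m) (tower O A (m + 1)) hle (fun _ _ t _ => hSTD t)

/-- **One tower step from STD (universal-property form, VERBATIM the hypothesis of
`PersistenceSTDStep.image_coe_subset_image_coe_of_omegaClosure`).** [cite: Esentepe2018, Thm. 5.1] -/
theorem ca_subset_ca_succ_of_forall (O : ValuationSubring K) (A : Subalgebra k K)
    (hk : ∀ c : k, algebraMap k K c ∈ O) (hA : A.FG) (hfr : IsFractionRing ↥A K)
    (hAO : A.toSubring ≤ O.toSubring) (m : ℕ) (hle : tower O A m ≤ tower O A (m + 1))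
    (hSTD : letI := (Subalgebra.inclusion hle).toRingHom.toAlgebra
      ∀ c : ↥(tower O A m), c ∈ cohomologyAnnihilator ↥(tower O A m) →
      ∀ t : ℕ, c ∈ cohomologyAnnihilatorOfDegree ↥(tower O A m) (t + 1) → ∃ e : ℕ,
      ∀ (M N : ModuleCat.{0} ↥(tower O A (m + 1))), Module.Finite ↥(tower O A (m + 1)) M →
        IsSyzygy e M N →
      ∀ Q : ModuleCat.{0} ↥(tower O A (m + 1)) → Prop,
        (∀ Y : ModuleCat.{0} ↥(tower O A (m + 1)),
          (∃ (X Y₀ : ModuleCat.{0} ↥(tower O A m)) (φ : Y₀ →+ Y),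
            Module.Finite ↥(tower O A m) X ∧ IsSyzygy (t + 1) X Y₀ ∧
            (∀ (b : ↥(tower O A m)) (y : Y₀),
              φ (b • y) = algebraMap ↥(tower O A m) ↥(tower O A (m + 1)) b • φ y) ∧
            Function.Injective φ ∧ Submodule.span ↥(tower O A (m + 1)) (Set.range φ) = ⊤) → Q Y) →
        (∀ P : ModuleCat.{0} ↥(tower O A (m + 1)), Module.Finite ↥(tower O A (m + 1)) P →
          Projective P → Q P) →
        (∀ Y Y' : ModuleCat.{0} ↥(tower O A (m + 1)), Q Y → Nonempty (Y ≅ Y') → Q Y') →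
        (∀ Y₁ Y₂ : ModuleCat.{0} ↥(tower O A (m + 1)), Q Y₁ → Q Y₂ →
          Q (ModuleCat.of ↥(tower O A (m + 1)) (Y₁ × Y₂))) →
        (∀ (Y Y' : ModuleCat.{0} ↥(tower O A (m + 1))) (i : Y' ⟶ Y) (r : Y ⟶ Y'),
          i ≫ r = 𝟙 Y' → Q Y → Q Y') →
        (∀ Y N' : ModuleCat.{0} ↥(tower O A (m + 1)), Q Y → IsSyzygy 1 Y N' → Q N') → Q N) :
    ca (tower O A m) ⊆ ca (tower O A (m + 1)) := by
  obtain ⟨hAT, -, hET⟩ := tn_tower_invariant O A hk hA hfr hAO m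
  obtain ⟨-, -, hET'⟩ := tn_tower_invariant O A hk hA hfr hAO (m + 1)
  haveI := hET
  haveI := hET'
  haveI := hfr
  haveI : IsNoetherianRing ↥(tower O A m) := Algebra.EssFiniteType.isNoetherianRing k _
  haveI : IsNoetherianRing ↥(tower O A (m + 1)) := Algebra.EssFiniteType.isNoetherianRing k _
  haveI : IsFractionRing ↥(tower O A m) K := isFractionRing_subalgebra_of_le A _ hAT
  rw [ca_eq_image, ca_eq_image]
  exact image_coe_subset_image_coe_of_omegaClosure (tower O A m) (tower O A (m + 1)) hle hSTD

/-- **`Persistence` from STD at every step (named form), route binders verbatim.** If for every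
stage the inclusion `T_m → T_(m+1)` satisfies STD_{t,e} for every `t` (some `e`), then
`∀ m, ca (tower O A m) ⊆ ca (tower O A (m+1))` — the conclusion of the crux (`p`, `CharP k p`
decorative). [cite: Esentepe2018, Thm. 5.1] -/
theorem persistence_of_STD (p : ℕ) (_hp : p.Prime) (k K : Type) [Field k] [CharP k p] [Field K]
    [Algebra k K] (O : ValuationSubring K) (A : Subalgebra k K) (hk : ∀ c : k, algebraMap k K c ∈ O)
    (hA : A.FG) (hfr : IsFractionRing ↥A K) (hAO : A.toSubring ≤ O.toSubring)
    (hSTD : ∀ (m : ℕ) (hle : tower O A m ≤ tower O A (m + 1)),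
      letI := (Subalgebra.inclusion hle).toRingHom.toAlgebra
      ∀ t : ℕ, ∃ e : ℕ, STD ↥(tower O A m) ↥(tower O A (m + 1)) t e) :
    ∀ m : ℕ, ca (tower O A m) ⊆ ca (tower O A (m + 1)) := by
  intro m
  -- `T_m ≤ T_(m+1)`: `T_(m+1) = loc (nrm (chart T_m)) ⊇ chart T_m ⊇ T_m`
  have hle : tower O A m ≤ tower O A (m + 1) := fun y hy => by
    rw [tower_succ]
    exact SyzygyFlattening.self_le_locAt O _
      (SyzygyFlattening.self_le_nrm _ (Algebra.subset_adjoin (Or.inl hy)))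
  exact ca_subset_ca_succ_of_STD O A hk hA hfr hAO m hle (hSTD m hle)

/-- **The crux `Persistence` BY NAME from STD along every canonical tower** (the composition of a
reshape-5 skeleton with ONE x-free structural stub `stub_STD`): if for all route data
`(p, k, K, O, A)` and every `m` the inclusion `T_m → T_(m+1)` satisfies STD_{t,e} for every `t`
(some `e`), then `HomologicalConductor.Persistence` holds. (A conditional proof of the route item:
it credits nothing until `stub_STD` is proved; recorded for the line.) [cite: Esentepe2018, Thm. 5.1] -/
theorem Persistence_of_STD
    (hSTD : ∀ p : ℕ, p.Prime → ∀ (k K : Type) [Field k] [CharP k p] [Field K] [Algebra k K]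
      (O : ValuationSubring K) (A : Subalgebra k K), (∀ c : k, algebraMap k K c ∈ O) → A.FG →
      IsFractionRing ↥A K → A.toSubring ≤ O.toSubring →
      ∀ (m : ℕ) (hle : tower O A m ≤ tower O A (m + 1)),
        letI := (Subalgebra.inclusion hle).toRingHom.toAlgebra
        ∀ t : ℕ, ∃ e : ℕ, STD ↥(tower O A m) ↥(tower O A (m + 1)) t e) :
    Persistence := by
  intro p hp k K _ _ _ _ O A hk hA hfr hAO
  exact persistence_of_STD p hp k K O A hk hA hfr hAO (hSTD p hp k K O A hk hA hfr hAO)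

/-- **T3a `persistence_of_STD_tower` — the reshape-5 COMPOSITION in the planner's binder shape
(`PlanSignaturesSTD-v0.3`, `STDHom (Subalgebra.inclusion hle).toRingHom t e` unfolded, since the
planner's `STDHom` is a sketch-side definition): if for all char-free tower data `(k, K, O, A)`,
every `m`, every proof `hle : T_m ≤ T_(m+1)` and every `t` there is an `e` such that every `e`-th
syzygy of a finitely generated `↥T_(m+1)`-module lies in every class containing the strict
transforms of `(t+1)`-th `↥T_m`-syzygies along `Subalgebra.inclusion hle` and the finitely
generated projectives, closed under isomorphism, binary products, retracts and first syzygies —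
then the crux `HomologicalConductor.Persistence` holds BY NAME. Proof: at stage `m` this is the
hypothesis of `ca_subset_ca_succ_of_forall` (stub-2's step lemma p466788), the algebra structure
being the inclusion (`algebraMap = (Subalgebra.inclusion hle).toRingHom` definitionally).
(Conditional proof of the route item: credits nothing until `stub_STD_tower` is proved.)
[cite: Esentepe2018, Thm. 5.1] -/
theorem persistence_of_STD_tower
    (hSTD : ∀ (k K : Type) [Field k] [Field K] [Algebra k K] (O : ValuationSubring K)
      (A : Subalgebra k K), (∀ c : k, algebraMap k K c ∈ O) → A.FG → IsFractionRing ↥A K →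
      A.toSubring ≤ O.toSubring →
      ∀ (m : ℕ) (hle : tower O A m ≤ tower O A (m + 1)) (t : ℕ), ∃ e : ℕ,
      ∀ (M N : ModuleCat.{0} ↥(tower O A (m + 1))), Module.Finite ↥(tower O A (m + 1)) M →
        IsSyzygy e M N →
      ∀ Q : ModuleCat.{0} ↥(tower O A (m + 1)) → Prop,
        (∀ Y : ModuleCat.{0} ↥(tower O A (m + 1)),
          (∃ (X Y₀ : ModuleCat.{0} ↥(tower O A m)) (φ : Y₀ →+ Y),
            Module.Finite ↥(tower O A m) X ∧ IsSyzygy (t + 1) X Y₀ ∧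
            (∀ (b : ↥(tower O A m)) (y : Y₀),
              φ (b • y) = (Subalgebra.inclusion hle).toRingHom b • φ y) ∧
            Function.Injective φ ∧ Submodule.span ↥(tower O A (m + 1)) (Set.range φ) = ⊤) → Q Y) →
        (∀ P : ModuleCat.{0} ↥(tower O A (m + 1)), Module.Finite ↥(tower O A (m + 1)) P →
          Projective P → Q P) →
        (∀ Y Y' : ModuleCat.{0} ↥(tower O A (m + 1)), Q Y → Nonempty (Y ≅ Y') → Q Y') →
        (∀ Y₁ Y₂ : ModuleCat.{0} ↥(tower O A (m + 1)), Q Y₁ → Q Y₂ →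
          Q (ModuleCat.of ↥(tower O A (m + 1)) (Y₁ × Y₂))) →
        (∀ (Y Y' : ModuleCat.{0} ↥(tower O A (m + 1))) (i : Y' ⟶ Y) (r : Y ⟶ Y'),
          i ≫ r = 𝟙 Y' → Q Y → Q Y') →
        (∀ Y N' : ModuleCat.{0} ↥(tower O A (m + 1)), Q Y → IsSyzygy 1 Y N' → Q N') → Q N) :
    Persistence := by
  intro p _ k K _ _ _ _ O A hk hA hfr hAO
  have key : ∀ m : ℕ, ca (tower O A m) ⊆ ca (tower O A (m + 1)) := by
    intro m
    -- `T_m ≤ T_(m+1)`: `T_(m+1) = loc (nrm (chart T_m)) ⊇ chart T_m ⊇ T_m`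
    have hle : tower O A m ≤ tower O A (m + 1) := fun y hy => by
      rw [tower_succ]
      exact SyzygyFlattening.self_le_locAt O _
        (SyzygyFlattening.self_le_nrm _ (Algebra.subset_adjoin (Or.inl hy)))
    exact ca_subset_ca_succ_of_forall O A hk hA hfr hAO m hle
      (fun _ _ t _ => hSTD k K O A hk hA hfr hAO m hle t)
  exact key

/-- **Line `std`'s glue stub `stub_persistence_of_STD_tower` with the planner's `STDHom` unfolded**
(binder order verbatim `Lines-std.lean`): STD along the tower, universal-property form, gives
`∀ m, ca (T_m) ⊆ ca (T_(m+1))`. [cite: Esentepe2018, Thm. 5.1] -/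
theorem ca_tower_succ_of_STDHom : ∀ (k K : Type) [Field k] [Field K] [Algebra k K]
    (O : ValuationSubring K) (A : Subalgebra k K), (∀ c : k, algebraMap k K c ∈ O) → A.FG →
    IsFractionRing ↥A K → A.toSubring ≤ O.toSubring →
    (∀ (m : ℕ) (hle : tower O A m ≤ tower O A (m + 1)) (t : ℕ), ∃ e : ℕ,
      ∀ (M N : ModuleCat.{0} ↥(tower O A (m + 1))), Module.Finite ↥(tower O A (m + 1)) M →
        IsSyzygy e M N →
      ∀ Q : ModuleCat.{0} ↥(tower O A (m + 1)) → Prop,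
        (∀ Y : ModuleCat.{0} ↥(tower O A (m + 1)),
          (∃ (X Y₀ : ModuleCat.{0} ↥(tower O A m)) (φ : Y₀ →+ Y),
            Module.Finite ↥(tower O A m) X ∧ IsSyzygy (t + 1) X Y₀ ∧
            (∀ (b : ↥(tower O A m)) (y : Y₀),
              φ (b • y) = (Subalgebra.inclusion hle).toRingHom b • φ y) ∧
            Function.Injective φ ∧ Submodule.span ↥(tower O A (m + 1)) (Set.range φ) = ⊤) → Q Y) →
        (∀ P : ModuleCat.{0} ↥(tower O A (m + 1)), Module.Finite ↥(tower O A (m + 1)) P →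
          Projective P → Q P) →
        (∀ Y Y' : ModuleCat.{0} ↥(tower O A (m + 1)), Q Y → Nonempty (Y ≅ Y') → Q Y') →
        (∀ Y₁ Y₂ : ModuleCat.{0} ↥(tower O A (m + 1)), Q Y₁ → Q Y₂ →
          Q (ModuleCat.of ↥(tower O A (m + 1)) (Y₁ × Y₂))) →
        (∀ (Y Y' : ModuleCat.{0} ↥(tower O A (m + 1))) (i : Y' ⟶ Y) (r : Y ⟶ Y'),
          i ≫ r = 𝟙 Y' → Q Y → Q Y') →
        (∀ Y N' : ModuleCat.{0} ↥(tower O A (m + 1)), Q Y → IsSyzygy 1 Y N' → Q N') → Q N) →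
    ∀ m : ℕ, ca (tower O A m) ⊆ ca (tower O A (m + 1)) := by
  intro k K _ _ _ O A hk hA hfr hAO hSTD m
  -- `T_m ≤ T_(m+1)`: `T_(m+1) = loc (nrm (chart T_m)) ⊇ chart T_m ⊇ T_m`
  have hle : tower O A m ≤ tower O A (m + 1) := fun y hy => by
    rw [tower_succ]
    exact SyzygyFlattening.self_le_locAt O _
      (SyzygyFlattening.self_le_nrm _ (Algebra.subset_adjoin (Or.inl hy)))
  exact ca_subset_ca_succ_of_forall O A hk hA hfr hAO m hle (fun _ _ t _ => hSTD m hle t)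

end Summit.ResolutionOfSingularities.ResolutionOfSingularities.Theorems.HomologicalConductor.PersistenceOfSTD

end
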